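import Mathlib
import HarnessLib.Audit

/-!
# A counterexample to the matrix Descartes rule of signs `z⁺(P) ≤ n·α(P)` on the class 𝕊

T. R. Cameron and P. J. Psarrakos, *On Descartes' rule of signs for matrix polynomials*,
Operators and Matrices 13 (2019), no. 3, 643–652, doi:10.7153/oam-2019-13-48
[cite: CameronPsarrakos2019], consider the class 𝕊 of self-adjoint
matrix polynomials `P(λ) = Σ_j λ^j A_j` (size `n`) all of whose coefficients are positive definite,
negative definite or null, write `α(P)` for the number of sign alternations in the sequence of nonnull
coefficients and `z⁺(P)` for the number of real positive eigenvalues counted with multiplicity, prove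
`z⁺(P) ≤ n·α(P)` (their inequality (6), Theorem 3) for hyperbolic members of 𝕊 and for degree ≤ 3
(Theorem 7), and state twice (end of §2 and §5): "We conjecture that (6) holds for all matrix
polynomials in 𝕊."

This file records the conjecture for real symmetric coefficients given in sparse form (`K` nonnull
coefficients at strictly increasing exponents, each positive or negative definite) as the Prop
`MatrixDescartesRule`, and REFUTES it (`not_matrixDescartesRule`) with an explicit member of 𝕊 of
size `n = 2`, degree 67, seven nonnull coefficients with sign pattern `+ + − + + + +` (so `α = 2`,
`n·α = 4`) whose determinant changes sign between the seven rational points `1/5, 1/2, 2, 4, 9/2, 5, 6`,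
hence has at least six distinct positive roots: `z⁺ ≥ 6 > 4`.

Provenance (pub-symmetroid cell, seat conjb-1, 2026-08-25): the object is the "softmax staircase"
of the rank-one-pivot analysis (`r1-kill/STAIRCASE.md`) rebuilt inside 𝕊 — one negative definite
letter `−(w wᵀ + 10⁻¹² diag(w₁², w₂²))` at exponent 3, positive definite diagonal letters
`diag(c, 10⁻¹² c)` / `diag(10⁻¹² c, c)` elsewhere (design `scratch/osc/oscS.py` seed 53, rates
(1; 1, 8, 64; 3, 2), 3-digit rationalisation, exact certificate `oscS_s53d3_certS.json`).
A real symmetric counterexample refutes the complex self-adjoint statement a fortiori.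
This is a statement about a FORMAT-LEVEL root law for symmetric matrix polynomials; it is not, and is
not worded as, evidence about `MatrixDescartes` or VH.

HONEST FRAMING (tree landing, typer g7 on the desk's R1273 plan; author conjb-1 g0).  Landed as a HELPER of the crux
item `stmt-ValiantsHypothesis-18050` (`Theses.LacunarySymmetroid.MatrixDescartes`) with NO closure claim: NEGATIVE
KNOWLEDGE for the `MatrixDescartes` programme — a root law for symmetric pencils must count letters / format, never sign
alternations.  The published conjecture is typed as the obligation node `@[conjecture] def MatrixDescartesRule` (their
inequality (6) restricted to real symmetric coefficients in sparse form, [cite: CameronPsarrakos2019, §2 end and §5: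
«We conjecture that (6) holds for all matrix polynomials in 𝕊»]) and refuted by name (`@[refutes] theorem
not_matrixDescartesRule`).  It says nothing about `KPlusLogSqLaw`, `MatrixDescartes` or `VP ≠ VNP`; it is not census
news.  Verified exactly at three seats (producer conjb-1, desk R1273, referee g45 l.6211/6212) before landing.
-/

-- `Summit.ValiantsHypothesis.ValiantsHypothesis.…` repeats a component by the D-0017 layout
-- (single-conjunct summit), which the `dupNamespace` linter flags; the name is mandated.
set_option linter.dupNamespace false

namespace Summit.ValiantsHypothesis.ValiantsHypothesis.Theorems.LacunarySymmetroidMatrixDescartes.SignRule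

open Polynomial Matrix Finset

/-- A sparse presentation of a (real symmetric) member of the Cameron–Psarrakos class 𝕊:
`K` nonnull coefficients `A k` at strictly increasing exponents `d k`, the `k`-th one positive
definite if `σ k = true` and negative definite if `σ k = false`. [definition, CameronPsarrakos2019 §2 (class 𝕊), sparse real-symmetric form of the cell] -/
def InClassS {n K : ℕ} (d : Fin K → ℕ) (A : Fin K → Matrix (Fin n) (Fin n) ℝ) (σ : Fin K → Bool) :
    Prop :=
  StrictMono d ∧ ∀ k, if σ k then (A k).PosDef else (-A k).PosDef

/-- number of sign alternations `α` between consecutive nonnull coefficients [definition, CameronPsarrakos2019 §2] -/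
def alternations {K : ℕ} (σ : Fin K → Bool) : ℕ :=
  (((List.ofFn σ).zip (List.ofFn σ).tail).filter (fun p => p.1 != p.2)).length

/-- the matrix polynomial `Σ_k X^{d k} A_k` [definition of the cell] -/
noncomputable def matPoly {n K : ℕ} (d : Fin K → ℕ) (A : Fin K → Matrix (Fin n) (Fin n) ℝ) :
    Matrix (Fin n) (Fin n) ℝ[X] :=
  ∑ k, ((X : ℝ[X]) ^ d k) • (A k).map C

/-- `z⁺`: the number of real positive eigenvalues (positive roots of `det`), with multiplicity [definition, CameronPsarrakos2019 §2] -/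
noncomputable def posEig {n K : ℕ} (d : Fin K → ℕ) (A : Fin K → Matrix (Fin n) (Fin n) ℝ) : ℕ :=
  Multiset.card (((matPoly d A).det).roots.filter (fun r => 0 < r))

/-- **The Cameron–Psarrakos matrix Descartes rule of signs (CONJECTURE, here REFUTED).**  Inequality (6) of
Cameron–Psarrakos, `z⁺(P) ≤ n · α(P)`, asserted for every member of 𝕊 — their conjecture («We conjecture that (6) holds
for all matrix polynomials in 𝕊»), restricted to real symmetric coefficients in sparse form (a real symmetric
counterexample refutes the complex self-adjoint statement a fortiori).  Typed as an obligation node and refuted below by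
`not_matrixDescartesRule`; NOT a vendored fact. [cite: CameronPsarrakos2019, §2 (end) and §5; inequality (6)] -/
@[conjecture] def MatrixDescartesRule : Prop :=
  ∀ (n K : ℕ) (d : Fin K → ℕ) (A : Fin K → Matrix (Fin n) (Fin n) ℝ) (σ : Fin K → Bool),
    InClassS d A σ → posEig d A ≤ n * alternations σ

/-! ## The witness: `n = 2`, seven letters at exponents 0, 2, 3, 4, 5, 11, 67 -/

/-- exponents of the seven nonnull coefficients -/
def dS : Fin 7 → ℕ := ![0, 2, 3, 4, 5, 11, 67]

/-- signs: all positive definite except the letter at exponent 3 -/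
def σS : Fin 7 → Bool := ![true, true, false, true, true, true, true]
/-- the negative definite letter is `-pivS`, `pivS = w wᵀ + 10⁻¹²·diag(w₁², w₂²)` with `w = (1479 / 1000, 1441 / 10000)` -/
noncomputable def pivS : Matrix (Fin 2) (Fin 2) ℝ := !![2187441000002187441 / 1000000000000000000, 2131239 / 10000000; 2131239 / 10000000, 2076481000002076481 / 100000000000000000000]

/-- the seven coefficients (diagonal positive definite letters and `-pivS`) -/
noncomputable def AS : Fin 7 → Matrix (Fin 2) (Fin 2) ℝ := ![
  Matrix.diagonal ![1 / 1000000000000, 1],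
  Matrix.diagonal ![689 / 1250, 689 / 1250000000000000],
  -pivS,
  Matrix.diagonal ![907 / 500, 907 / 500000000000000],
  Matrix.diagonal ![2521 / 5000000000000000000, 2521 / 5000000],
  Matrix.diagonal ![619 / 5000000, 619 / 5000000000000000000],
  Matrix.diagonal ![2859 / 10000000000000000000000000000000000000000000, 2859 / 10000000000000000000000000000000000000000000000000000000]]

/-- the exponents are strictly increasing -/
theorem dS_strictMono : StrictMono dS := by
  refine Fin.strictMono_iff_lt_succ.2 ?_
  intro i
  fin_cases i <;> simp [dS]

/-- `α = 2` for the witness -/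
theorem alternations_σS : alternations σS = 2 := by decide

/-- `pivS` is positive definite (so the letter at exponent `3`, `-pivS`, is negative definite) -/
theorem pivS_posDef : pivS.PosDef := by
  refine Matrix.PosDef.of_dotProduct_mulVec_pos ?_ ?_
  · -- real symmetric
    rw [Matrix.IsHermitian]
    ext i j
    fin_cases i <;> fin_cases j <;> simp [pivS]
  · intro x hx
    have hx' : x 0 ≠ 0 ∨ x 1 ≠ 0 := by
      by_contra h
      push Not at h
      apply hx
      ext i
      fin_cases i <;> simp [h.1, h.2]
    have hq : star x ⬝ᵥ (pivS *ᵥ x)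
        = (2187441000002187441 / 1000000000000000000 : ℝ) * x 0 * x 0 + 2 * ((2131239 / 10000000 : ℝ)) * x 0 * x 1 + (2076481000002076481 / 100000000000000000000 : ℝ) * x 1 * x 1 := by
      simp [pivS, Matrix.mulVec, dotProduct, Fin.sum_univ_two]
      ring
    rw [hq]
    rcases hx' with h0 | h1
    · have := sq_pos_of_ne_zero h0
      nlinarith [sq_nonneg ((1479 / 1000 : ℝ) * x 0 + (1441 / 10000 : ℝ) * x 1), sq_nonneg (x 1)]
    · have := sq_pos_of_ne_zero h1
      nlinarith [sq_nonneg ((1479 / 1000 : ℝ) * x 0 + (1441 / 10000 : ℝ) * x 1), sq_nonneg (x 0)]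

/-- the witness lies in the class 𝕊 -/
theorem inClassS_S : InClassS dS AS σS := by
  refine ⟨dS_strictMono, ?_⟩
  intro k
  fin_cases k
  all_goals simp only [σS, AS]
  all_goals simp [Matrix.posDef_diagonal_iff, Fin.forall_fin_two, pivS_posDef]

/-- the determinant of the witness -/
noncomputable def detS : ℝ[X] := (matPoly dS AS).det

/-- the determinant of the witness evaluated at a real point, as a `2 × 2` expansion -/
theorem detS_eval (t : ℝ) : detS.eval t =
    (∑ k, AS k 0 0 * t ^ dS k) * (∑ k, AS k 1 1 * t ^ dS k)
      - (∑ k, AS k 0 1 * t ^ dS k) * (∑ k, AS k 1 0 * t ^ dS k) := by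
  unfold detS matPoly
  rw [Matrix.det_fin_two]
  simp [Matrix.sum_apply, Matrix.smul_apply, eval_finsetSum]

/-- sign `+` at `1/5` -/
theorem sign1 : 0 < detS.eval (1 / 5 : ℝ) := by
  rw [detS_eval]
  simp [Fin.sum_univ_succ, dS, AS, pivS, Matrix.diagonal]
  norm_num

/-- sign `−` at `1/2` -/
theorem sign2 : detS.eval (1 / 2 : ℝ) < 0 := by
  rw [detS_eval]
  simp [Fin.sum_univ_succ, dS, AS, pivS, Matrix.diagonal]
  norm_num

/-- sign `+` at `2` -/
theorem sign3 : 0 < detS.eval (2 : ℝ) := by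
  rw [detS_eval]
  simp [Fin.sum_univ_succ, dS, AS, pivS, Matrix.diagonal]
  norm_num

/-- sign `−` at `4` -/
theorem sign4 : detS.eval (4 : ℝ) < 0 := by
  rw [detS_eval]
  simp [Fin.sum_univ_succ, dS, AS, pivS, Matrix.diagonal]
  norm_num

/-- sign `+` at `9/2` -/
theorem sign5 : 0 < detS.eval (9 / 2 : ℝ) := by
  rw [detS_eval]
  simp [Fin.sum_univ_succ, dS, AS, pivS, Matrix.diagonal]
  norm_num

/-- sign `−` at `5` -/
theorem sign6 : detS.eval (5 : ℝ) < 0 := by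
  rw [detS_eval]
  simp [Fin.sum_univ_succ, dS, AS, pivS, Matrix.diagonal]
  norm_num

/-- sign `+` at `6` -/
theorem sign7 : 0 < detS.eval (6 : ℝ) := by
  rw [detS_eval]
  simp [Fin.sum_univ_succ, dS, AS, pivS, Matrix.diagonal]
  norm_num

/-- the determinant is not the zero polynomial -/
theorem detS_ne_zero : detS ≠ 0 := by
  intro h
  have h1 := sign1
  rw [h, eval_zero] at h1
  exact lt_irrefl _ h1

/-- sign change ⇒ a root strictly inside -/
theorem exists_root_of_sign_change {a b : ℝ} (hab : a ≤ b)
    (ha : detS.eval a < 0 ∨ 0 < detS.eval a) (h : detS.eval a * detS.eval b < 0) :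
    ∃ r ∈ Set.Ioo a b, detS.IsRoot r := by
  have hcont : ContinuousOn (fun x => detS.eval x) (Set.Icc a b) := detS.continuous.continuousOn
  rcases ha with ha | ha
  · have hb : 0 < detS.eval b := by
      by_contra hb; push Not at hb; nlinarith
    exact intermediate_value_Ioo hab hcont ⟨ha, hb⟩
  · have hb : detS.eval b < 0 := by
      by_contra hb; push Not at hb; nlinarith
    exact intermediate_value_Ioo' hab hcont ⟨hb, ha⟩

/-- **At least six positive eigenvalues.** -/
theorem six_le_posEig : 6 ≤ posEig dS AS := by
  obtain ⟨r1, hr1, h1⟩ := exists_root_of_sign_change (a := (1 / 5 : ℝ)) (b := (1 / 2 : ℝ)) (by norm_num) (Or.inr sign1)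
    (by nlinarith [sign1, sign2])
  obtain ⟨r2, hr2, h2⟩ := exists_root_of_sign_change (a := (1 / 2 : ℝ)) (b := (2 : ℝ)) (by norm_num) (Or.inl sign2)
    (by nlinarith [sign2, sign3])
  obtain ⟨r3, hr3, h3⟩ := exists_root_of_sign_change (a := (2 : ℝ)) (b := (4 : ℝ)) (by norm_num) (Or.inr sign3)
    (by nlinarith [sign3, sign4])
  obtain ⟨r4, hr4, h4⟩ := exists_root_of_sign_change (a := (4 : ℝ)) (b := (9 / 2 : ℝ)) (by norm_num) (Or.inl sign4)
    (by nlinarith [sign4, sign5])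
  obtain ⟨r5, hr5, h5⟩ := exists_root_of_sign_change (a := (9 / 2 : ℝ)) (b := (5 : ℝ)) (by norm_num) (Or.inr sign5)
    (by nlinarith [sign5, sign6])
  obtain ⟨r6, hr6, h6⟩ := exists_root_of_sign_change (a := (5 : ℝ)) (b := (6 : ℝ)) (by norm_num) (Or.inl sign6)
    (by nlinarith [sign6, sign7])
  -- the six roots are positive and strictly increasing
  let r : Fin 6 → ℝ := ![r1, r2, r3, r4, r5, r6]
  have h12 : r1 < r2 := lt_trans hr1.2 hr2.1
  have h23 : r2 < r3 := lt_trans hr2.2 hr3.1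
  have h34 : r3 < r4 := lt_trans hr3.2 hr4.1
  have h45 : r4 < r5 := lt_trans hr4.2 hr5.1
  have h56 : r5 < r6 := lt_trans hr5.2 hr6.1
  have h0 : 0 < r1 := lt_trans (by norm_num) hr1.1
  have hmono : StrictMono r := by
    refine Fin.strictMono_iff_lt_succ.2 ?_
    intro i
    fin_cases i
    · exact h12
    · exact h23
    · exact h34
    · exact h45
    · exact h56
  have hpos : ∀ i, 0 < r i := by
    intro i
    fin_cases i
    · exact h0
    · exact lt_trans h0 h12
    · exact lt_trans (lt_trans h0 h12) h23
    · exact lt_trans (lt_trans (lt_trans h0 h12) h23) h34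
    · exact lt_trans (lt_trans (lt_trans (lt_trans h0 h12) h23) h34) h45
    · exact lt_trans (lt_trans (lt_trans (lt_trans (lt_trans h0 h12) h23) h34) h45) h56
  have hroot : ∀ i, detS.IsRoot (r i) := by
    intro i
    fin_cases i
    · exact h1
    · exact h2
    · exact h3
    · exact h4
    · exact h5
    · exact h6
  have hsub : Finset.univ.image r ⊆ (detS.roots.filter (fun t => 0 < t)).toFinset := by
    intro t ht
    obtain ⟨i, _, rfl⟩ := Finset.mem_image.1 ht
    rw [Multiset.mem_toFinset, Multiset.mem_filter]
    exact ⟨(Polynomial.mem_roots detS_ne_zero).2 (hroot i), hpos i⟩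
  have hcard : (Finset.univ.image r).card = 6 := by
    rw [Finset.card_image_of_injective _ hmono.injective]
    simp
  unfold posEig
  calc 6 = (Finset.univ.image r).card := hcard.symm
    _ ≤ (detS.roots.filter (fun t => 0 < t)).toFinset.card := Finset.card_le_card hsub
    _ ≤ Multiset.card (detS.roots.filter (fun t => 0 < t)) := Multiset.toFinset_card_le _

/-- **The matrix Descartes rule `z⁺ ≤ n·α` fails on 𝕊** (n = 2, α = 2, z⁺ ≥ 6): the conjecture
[cite: CameronPsarrakos2019, §2/§5, inequality (6)] is FALSE. -/
@[refutes] theorem not_matrixDescartesRule : ¬ MatrixDescartesRule := by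
  intro h
  have h4 : posEig dS AS ≤ 2 * alternations σS := h 2 7 dS AS σS inClassS_S
  rw [alternations_σS] at h4
  have h6 := six_le_posEig
  omega

end Summit.ValiantsHypothesis.ValiantsHypothesis.Theorems.LacunarySymmetroidMatrixDescartes.SignRule
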